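import Summits.KontsevichZagierPeriods.KontsevichZagierPeriods.Theorems.SoloInformedNLSides
import HarnessLib
import HarnessLib.Audit

/-!
# SoloInformed — the signed multiplicities of the left and right sheets agree pointwise (Newton–Leibniz elimination, file 4c-ii-d3)

Solo programme `solo-KontsevichZagierPeriods-informed`, session s245 (K-NF, `paper/nl-elimination.md`
§7.2, FILE 4c-ii, assembly part 3).

For a frame `Φ` (files 4c-ii-d1/d2) and a second `ℚ`-cylindrical decomposition `𝒯'` adapted to the
crossing graphs `{y = F(x, ξ(x))}` of the sections bounding the bands inside `B` and to the graphs
`{y = F(x, a x)}`, `{y = F(x, b x)}`, at every point `w = (x, y)` of an open cell of `𝒯'` the signed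
number of left sheets through `w` equals the signed number of right sheets through `w`
(`SoloInformedNLFrame.multiplicity_eq`): both are the signed crossing number
`sInd (F(x, a x)) (F(x, b x)) y` (LEMMA C, files 590/598/599), or both vanish.

References: this work (THEOREM NF, `paper/nl-elimination.md` §2, KEY LEMMA (K) and LEMMA C).
-/

noncomputable section

open scoped BigOperators Topology ContDiff

namespace Summit.KontsevichZagierPeriods.KontsevichZagierPeriods.Theorems

open Set MeasureTheory Filter
open Literature.ModelTheory.ExponentialFields
open Literature.NumberTheory.Transcendental Literature.NumberTheory.Transcendental.KZ

variable {n : ℕ}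

section Telescope

variable {𝒯 : Finset (Set (Fin (n + 1) → ℝ))} {𝒮 : Finset (Set (Fin n → ℝ))}
  {lS : Set (Fin n → ℝ) → ℕ} {ξ : (S : Set (Fin n → ℝ)) → Fin (lS S) → (Fin n → ℝ) → ℝ}
  {τ : Set (Fin n → ℝ)} {a b : (Fin n → ℝ) → ℝ}
  {𝒞 : Finset (Set (Fin (n + 1) → ℝ))} {S : Set (Fin n → ℝ)}

open Classical in
/-- **Total signed multiplicity of the band sheets over one base point** (variant of file 599 with
genericity required only at the ends of the bands inside `B`): it is `sInd (F(x, a x)) (F(x, b x)) y`.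
-/
theorem soloInformed_sum_sign_mul_indicator_eq_sInd'
    (h𝒯 : Setoid.IsPartition (𝒯 : Set (Set (Fin (n + 1) → ℝ))))
    (h𝒮 : Setoid.IsPartition (𝒮 : Set (Set (Fin n → ℝ))))
    (hmono : ∀ S ∈ 𝒮, ∀ x ∈ S, StrictMono fun j => ξ S j x)
    (hmem : ∀ T, T ∈ 𝒯 ↔ ∃ S ∈ 𝒮, (∃ j, T = graphOver S (ξ S j)) ∨ ∃ j, T = bandOver S (ξ S) j)
    (h𝒞 : 𝒞 ⊆ 𝒯) (hU : ⋃₀ (𝒞 : Set (Set (Fin (n + 1) → ℝ))) = KZlog.band τ a b) (hS : S ∈ 𝒮)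
    (hSτ : S ⊆ τ) {F : (Fin (n + 1) → ℝ) → ℝ} {w : Fin (n + 1) → ℝ} (hx : Fin.init w ∈ S)
    (hab : a (Fin.init w) ≤ b (Fin.init w))
    (hcont : ContinuousOn (fun s : ℝ => F (Fin.snoc (Fin.init w) s))
      (Icc (a (Fin.init w)) (b (Fin.init w))))
    (ε : Fin (lS S + 1) → ℤ)
    (hε : ∀ (j : Fin (lS S + 1)) (h0 : j ≠ 0) (hl : j ≠ Fin.last (lS S)),
      bandOver S (ξ S) j ⊆ KZlog.band τ a b →
        SoloInformedPieceType (fun s : ℝ => F (Fin.snoc (Fin.init w) s))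
          (ξ S (j.pred h0) (Fin.init w)) (ξ S (j.castPred hl) (Fin.init w)) (ε j))
    (hy : ∀ (j : Fin (lS S + 1)) (h0 : j ≠ 0) (hl : j ≠ Fin.last (lS S)),
      bandOver S (ξ S) j ⊆ KZlog.band τ a b →
        w (Fin.last n) ≠ F (Fin.snoc (Fin.init w) (ξ S (j.pred h0) (Fin.init w))) ∧
        w (Fin.last n) ≠ F (Fin.snoc (Fin.init w) (ξ S (j.castPred hl) (Fin.init w)))) :
    ∑ j ∈ Finset.univ.filter (fun j : Fin (lS S + 1) => bandOver S (ξ S) j ⊆ KZlog.band τ a b),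
      ε j * (if w ∈ soloInformedLastSubst F '' bandOver S (ξ S) j then 1 else 0) =
      soloInformedSInd (F (Fin.snoc (Fin.init w) (a (Fin.init w))))
        (F (Fin.snoc (Fin.init w) (b (Fin.init w)))) (w (Fin.last n)) := by
  have hm := hmono S hS _ hx
  have hterm : ∀ j ∈ Finset.univ.filter
      (fun j : Fin (lS S + 1) => bandOver S (ξ S) j ⊆ KZlog.band τ a b),
      ε j * (if w ∈ soloInformedLastSubst F '' bandOver S (ξ S) j then 1 else 0) =
        soloInformedStepInd (F (Fin.snoc (Fin.init w) (bandLower (ξ S) j (Fin.init w)).toReal))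
            (w (Fin.last n)) -
          soloInformedStepInd (F (Fin.snoc (Fin.init w) (bandUpper (ξ S) j (Fin.init w)).toReal))
            (w (Fin.last n)) := by
    intro j hj
    rw [Finset.mem_filter] at hj
    obtain ⟨h0, hl, hlo, hhi⟩ := soloInformed_bounds_of_band_subset hmono hS hx hj.2
    have hlt : ξ S (j.pred h0) (Fin.init w) < ξ S (j.castPred hl) (Fin.init w) := by
      apply hm
      rw [Fin.lt_def, Fin.val_pred, Fin.coe_castPred]
      have := Fin.val_ne_of_ne h0
      rw [Fin.val_zero] at this
      omega
    rw [← soloInformed_sInd_eq_stepInd_band (ξ S) h0 hl]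
    exact soloInformed_sign_mul_indicator_image_band hx h0 hl hlt
      (hcont.mono (Icc_subset_Icc hlo hhi)) (hε j h0 hl hj.2) (hy j h0 hl hj.2).1 (hy j h0 hl hj.2).2
  rw [Finset.sum_congr rfl hterm]
  exact soloInformed_band_telescope h𝒯 h𝒮 hmono hmem h𝒞 hU hS hSτ hx hab
    (fun t => soloInformedStepInd (F (Fin.snoc (Fin.init w) t)) (w (Fin.last n))) _
    (fun j => by rw [Finset.mem_filter]; exact ⟨fun h => h.2, fun h => ⟨Finset.mem_univ _, h⟩⟩)

end Telescope

namespace SoloInformedNLFrame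

variable (Φ : SoloInformedNLFrame n)

/-- Cells of `𝒯` are nonempty. -/
theorem cell_nonempty {T : Set (Fin (n + 1) → ℝ)} (hT : T ∈ Φ.𝒯) : T.Nonempty :=
  Set.nonempty_iff_ne_empty.2 fun h => Φ.hpart.1 (by rw [← h]; exact Finset.mem_coe.2 hT)

/-- Consecutive sections over a point of a base cell are strictly ordered. -/
theorem lo_lt_hi {S : Set (Fin n → ℝ)} (hS : S ∈ Φ.𝒮) {x : Fin n → ℝ} (hx : x ∈ S)
    {j : Fin (Φ.lS S + 1)} (h0 : j ≠ 0) (hl : j ≠ Fin.last (Φ.lS S)) :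
    Φ.ξ S (j.pred h0) x < Φ.ξ S (j.castPred hl) x := by
  apply Φ.hmono S hS x hx
  rw [Fin.lt_def, Fin.val_pred, Fin.coe_castPred]
  have := Fin.val_ne_of_ne h0
  rw [Fin.val_zero] at this
  omega

/-- A band inside `B` over `S ∋ x` forces `x ∈ τ`. -/
theorem mem_τ_of_band_subset {S : Set (Fin n → ℝ)} (hS : S ∈ Φ.𝒮) {x : Fin n → ℝ} (hx : x ∈ S)
    {j : Fin (Φ.lS S + 1)} (hB : bandOver S (Φ.ξ S) j ⊆ Φ.r.domain) : x ∈ Φ.r'.domain := by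
  obtain ⟨t, ht1, ht2⟩ :=
    CylindricalDecomposition.exists_mem_band (Φ.ξ S) x (Φ.hmono S hS x hx) j
  have hz : (Fin.snoc x t : Fin (n + 1) → ℝ) ∈ bandOver S (Φ.ξ S) j :=
    snoc_mem_bandOver_iff.2 ⟨hx, ht1, ht2⟩
  have hzB := hB hz
  rw [Φ.hdom, KZlog.snoc_mem_band] at hzB
  exact hzB.1

/-- Band containment in `B`, with `B` written as the band over `τ`. -/
theorem band_subset_iff' {S : Set (Fin n → ℝ)} {j : Fin (Φ.lS S + 1)} :
    bandOver S (Φ.ξ S) j ⊆ Φ.r.domain ↔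
      bandOver S (Φ.ξ S) j ⊆ KZlog.band Φ.r'.domain Φ.a Φ.b := by
  rw [Φ.hdom]

/-- The lower crossing function `x ↦ F(x, ξ_{j-1} x)` of a band inside `B` is semialgebraic. -/
theorem isSemialgebraicFunOn_crossLo {S : Set (Fin n → ℝ)} (hS : S ∈ Φ.𝒮) {j : Fin (Φ.lS S + 1)}
    (hB : bandOver S (Φ.ξ S) j ⊆ Φ.r.domain) (h0 : j ≠ 0) :
    IsSemialgebraicFunOn ℚ S (fun x => Φ.F (Fin.snoc x (Φ.ξ S (j.pred h0) x))) := by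
  refine soloInformed_isSemialgebraicFunOn_comp_snoc (Φ.h𝒮.isSemialgebraic S hS) (Φ.hsaξ S hS _)
    Φ.hF fun x hx => ?_
  obtain ⟨h0', hl, hlo, hhi⟩ :=
    soloInformed_bounds_of_band_subset Φ.hmono hS hx (Φ.band_subset_iff'.1 hB)
  rw [Φ.hdom, KZlog.snoc_mem_band]
  exact ⟨Φ.mem_τ_of_band_subset hS hx hB, hlo, (Φ.lo_lt_hi hS hx h0 hl).le.trans hhi⟩

/-- The upper crossing function `x ↦ F(x, ξ_j x)` of a band inside `B` is semialgebraic. -/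
theorem isSemialgebraicFunOn_crossHi {S : Set (Fin n → ℝ)} (hS : S ∈ Φ.𝒮) {j : Fin (Φ.lS S + 1)}
    (hB : bandOver S (Φ.ξ S) j ⊆ Φ.r.domain) (hl : j ≠ Fin.last (Φ.lS S)) :
    IsSemialgebraicFunOn ℚ S (fun x => Φ.F (Fin.snoc x (Φ.ξ S (j.castPred hl) x))) := by
  refine soloInformed_isSemialgebraicFunOn_comp_snoc (Φ.h𝒮.isSemialgebraic S hS) (Φ.hsaξ S hS _)
    Φ.hF fun x hx => ?_
  obtain ⟨h0, hl', hlo, hhi⟩ :=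
    soloInformed_bounds_of_band_subset Φ.hmono hS hx (Φ.band_subset_iff'.1 hB)
  rw [Φ.hdom, KZlog.snoc_mem_band]
  exact ⟨Φ.mem_τ_of_band_subset hS hx hB, hlo.trans (Φ.lo_lt_hi hS hx h0 hl).le, hhi⟩

/-- The lower crossing function in `bandLower` form. -/
theorem crossLo_eq {S : Set (Fin n → ℝ)} {j : Fin (Φ.lS S + 1)} (h0 : j ≠ 0) :
    (fun x => Φ.F (Fin.snoc x (bandLower (Φ.ξ S) j x).toReal)) =
      fun x => Φ.F (Fin.snoc x (Φ.ξ S (j.pred h0) x)) := by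
  funext x
  rw [bandLower_of_ne_zero (Φ.ξ S) j h0 x, EReal.toReal_coe]

/-- The upper crossing function in `bandUpper` form. -/
theorem crossHi_eq {S : Set (Fin n → ℝ)} {j : Fin (Φ.lS S + 1)} (hl : j ≠ Fin.last (Φ.lS S)) :
    (fun x => Φ.F (Fin.snoc x (bandUpper (Φ.ξ S) j x).toReal)) =
      fun x => Φ.F (Fin.snoc x (Φ.ξ S (j.castPred hl) x)) := by
  funext x
  rw [bandUpper_of_ne_last (Φ.ξ S) j hl x, EReal.toReal_coe]

/-- Fibre points of an inner band. -/
theorem snoc_mem_band_of_mem_Ioo {S : Set (Fin n → ℝ)} {x : Fin n → ℝ} (hx : x ∈ S)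
    {j : Fin (Φ.lS S + 1)} (h0 : j ≠ 0) (hl : j ≠ Fin.last (Φ.lS S)) {t : ℝ}
    (ht : t ∈ Ioo (Φ.ξ S (j.pred h0) x) (Φ.ξ S (j.castPred hl) x)) :
    (Fin.snoc x t : Fin (n + 1) → ℝ) ∈ bandOver S (Φ.ξ S) j :=
  (snoc_mem_bandOver_iff_of_ne h0 hl).2 ⟨hx, ht⟩

/-- A nonempty subset of `N` is not a subset of `P`. -/
theorem not_subset_P_of_subset_N {A : Set (Fin (n + 1) → ℝ)} (hA : A.Nonempty) (hN : A ⊆ Φ.N) :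
    ¬ A ⊆ Φ.P := fun hP => by
  obtain ⟨z, hz⟩ := hA
  exact lt_irrefl (0 : ℝ) ((hP hz).2.trans (hN hz).2)

/-- A nonempty subset of `Z` is not a subset of `P`. -/
theorem not_subset_P_of_subset_Z {A : Set (Fin (n + 1) → ℝ)} (hA : A.Nonempty) (hZ : A ⊆ Φ.Z) :
    ¬ A ⊆ Φ.P := fun hP => by
  obtain ⟨z, hz⟩ := hA
  exact (hP hz).2.ne' (hZ hz).2

/-- A nonempty subset of `Z` is not a subset of `N`. -/
theorem not_subset_N_of_subset_Z {A : Set (Fin (n + 1) → ℝ)} (hA : A.Nonempty) (hZ : A ⊆ Φ.Z) :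
    ¬ A ⊆ Φ.N := fun hN => by
  obtain ⟨z, hz⟩ := hA
  exact (hN hz).2.ne (hZ hz).2

open Classical in
/-- The extended left sign: `+1` on `P`, `-1` on `N`, `0` otherwise. -/
def εL' (S : Set (Fin n → ℝ)) (j : Fin (Φ.lS S + 1)) : ℤ :=
  if bandOver S (Φ.ξ S) j ⊆ Φ.P then 1 else if bandOver S (Φ.ξ S) j ⊆ Φ.N then -1 else 0

open Classical in
/-- **Left multiplicity over the base cell of `x = init w`**: the signed number of left sheets
through `w` with base cell `S ∋ x` is `sInd (F(x, a x)) (F(x, b x)) (w last)`. -/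
theorem sum_JL_eq_sInd {S : Set (Fin n → ℝ)} (hS : S ∈ Φ.𝒮) (hSo : IsOpen S)
    (hSτ : S ⊆ Φ.r'.domain) {w : Fin (n + 1) → ℝ} (hx : Fin.init w ∈ S)
    (hy : ∀ (j : Fin (Φ.lS S + 1)) (h0 : j ≠ 0) (hl : j ≠ Fin.last (Φ.lS S)),
      bandOver S (Φ.ξ S) j ⊆ Φ.r.domain →
        w (Fin.last n) ≠ Φ.F (Fin.snoc (Fin.init w) (Φ.ξ S (j.pred h0) (Fin.init w))) ∧
        w (Fin.last n) ≠ Φ.F (Fin.snoc (Fin.init w) (Φ.ξ S (j.castPred hl) (Fin.init w)))) :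
    ∑ j ∈ Φ.JL S, Φ.εL ⟨S, j⟩ *
        (if w ∈ soloInformedLastSubst Φ.F '' bandOver S (Φ.ξ S) j then 1 else 0) =
      soloInformedSInd (Φ.F (Fin.snoc (Fin.init w) (Φ.a (Fin.init w))))
        (Φ.F (Fin.snoc (Fin.init w) (Φ.b (Fin.init w)))) (w (Fin.last n)) := by
  have hxτ : Fin.init w ∈ Φ.r'.domain := hSτ hx
  obtain ⟨𝒞B, h𝒞B, hUB⟩ := Φ.adB
  have hJL : ∑ j ∈ Φ.JL S, Φ.εL ⟨S, j⟩ *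
        (if w ∈ soloInformedLastSubst Φ.F '' bandOver S (Φ.ξ S) j then 1 else 0) =
      ∑ j ∈ Φ.JB S, Φ.εL' S j *
        (if w ∈ soloInformedLastSubst Φ.F '' bandOver S (Φ.ξ S) j then 1 else 0) := by
    rw [JL, Finset.sum_filter]
    refine Finset.sum_congr rfl fun j _ => ?_
    by_cases hP : bandOver S (Φ.ξ S) j ⊆ Φ.P
    · simp [εL', εL, hP]
    · by_cases hN : bandOver S (Φ.ξ S) j ⊆ Φ.N
      · simp [εL', εL, hP, hN]
      · simp [εL', hP, hN]
  have hJB : Φ.JB S = Finset.univ.filter fun j : Fin (Φ.lS S + 1) =>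
      bandOver S (Φ.ξ S) j ⊆ KZlog.band Φ.r'.domain Φ.a Φ.b := by
    ext j
    rw [Φ.mem_JB, Finset.mem_filter, Φ.band_subset_iff']
    simp
  rw [hJL, hJB]
  refine soloInformed_sum_sign_mul_indicator_eq_sInd' Φ.hpart Φ.hpartS Φ.hmono Φ.hmem h𝒞B
    (hUB.trans Φ.hdom) hS hSτ hx (Φ.hab _ hxτ) (Φ.hcont _ hxτ) (Φ.εL' S) (fun j h0 hl hjB => ?_)
    (fun j h0 hl hjB => hy j h0 hl (Φ.band_subset_iff'.2 hjB))
  have hjB' : bandOver S (Φ.ξ S) j ⊆ Φ.r.domain := Φ.band_subset_iff'.2 hjB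
  have hBo := soloInformed_isOpen_bandOver hSo (Φ.hcontξ S hS) j
  have hne := Φ.cell_nonempty (Φ.band_mem hS j)
  obtain ⟨h0', hl', hlo, hhi⟩ := soloInformed_bounds_of_band_subset Φ.hmono hS hx hjB
  refine soloInformed_pieceType_of_sign (Φ.hderiv _ hxτ) hlo hhi ?_
  rcases Φ.band_trichotomy hS hBo hjB' with hP | hN | hZ
  · exact Or.inl ⟨by simp [εL', hP], fun t ht => (hP (Φ.snoc_mem_band_of_mem_Ioo hx h0 hl ht)).2⟩
  · exact Or.inr (Or.inl ⟨by simp [εL', hN, Φ.not_subset_P_of_subset_N hne hN],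
      fun t ht => (hN (Φ.snoc_mem_band_of_mem_Ioo hx h0 hl ht)).2⟩)
  · exact Or.inr (Or.inr ⟨by simp [εL', Φ.not_subset_P_of_subset_Z hne hZ,
      Φ.not_subset_N_of_subset_Z hne hZ], fun t ht => (hZ (Φ.snoc_mem_band_of_mem_Ioo hx h0 hl ht)).2⟩)

open Classical in
/-- **Right multiplicity over the base cell of `x = init w`**: for a signed open cell `S ∋ x` inside
`τ`, the signed indicator of the right sheet at `w` is `sInd (F(x, a x)) (F(x, b x)) (w last)`. -/
theorem εR_mul_indicator_eq_sInd {S : Set (Fin n → ℝ)} (hS : S ∈ Φ.𝒮) (hSτ : S ⊆ Φ.r'.domain)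
    (hpm : S ⊆ Φ.τp ∨ S ⊆ Φ.τm) {w : Fin (n + 1) → ℝ} (hx : Fin.init w ∈ S)
    (hy₁ : w (Fin.last n) ≠ Φ.F (Fin.snoc (Fin.init w) (Φ.a (Fin.init w))))
    (hy₂ : w (Fin.last n) ≠ Φ.F (Fin.snoc (Fin.init w) (Φ.b (Fin.init w)))) :
    Φ.εR S * (if w ∈ soloInformedLastSubst
        (soloInformedShear (fun x => Φ.F (Fin.snoc x (Φ.a x))) Φ.r'.integrand) ''
          (Φ.slabRep S).domain then 1 else 0) =
      soloInformedSInd (Φ.F (Fin.snoc (Fin.init w) (Φ.a (Fin.init w))))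
        (Φ.F (Fin.snoc (Fin.init w) (Φ.b (Fin.init w)))) (w (Fin.last n)) := by
  have hxτ := hSτ hx
  rw [Φ.hF_b _ hxτ]
  refine soloInformed_sign_mul_indicator_image_shear (Φ.slabRep_domain hS hSτ) hx ?_ hy₁
    (by rw [← Φ.hF_b _ hxτ]; exact hy₂)
  by_cases hp : S ⊆ Φ.τp
  · exact Or.inl ⟨by rw [εR, if_pos hp], (hp hx).2⟩
  · exact Or.inr ⟨by rw [εR, if_neg hp], ((hpm.resolve_left hp) hx).2⟩

open Classical in
/-- **The signed multiplicities of the left and the right sheets agree** at every point of an open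
cell of a decomposition `𝒯'` adapted to the crossing graphs of the sections bounding the bands
inside `B` and to the graphs of `F(·, a ·)`, `F(·, b ·)` over the base cells inside `τ`. -/
theorem multiplicity_eq {𝒯' : Finset (Set (Fin (n + 1) → ℝ))}
    (h𝒯' : IsCylindricalDecomposition ℚ (n + 1) 𝒯')
    (hlo : ∀ p ∈ Φ.𝒮.sigma Φ.JB, ∃ 𝒞, 𝒞 ⊆ 𝒯' ∧ ⋃₀ (𝒞 : Set (Set (Fin (n + 1) → ℝ))) =
      graphOver p.1 (fun x => Φ.F (Fin.snoc x (bandLower (Φ.ξ p.1) p.2 x).toReal)))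
    (hhi : ∀ p ∈ Φ.𝒮.sigma Φ.JB, ∃ 𝒞, 𝒞 ⊆ 𝒯' ∧ ⋃₀ (𝒞 : Set (Set (Fin (n + 1) → ℝ))) =
      graphOver p.1 (fun x => Φ.F (Fin.snoc x (bandUpper (Φ.ξ p.1) p.2 x).toReal)))
    (ha : ∀ S ∈ Φ.Sτ, ∃ 𝒞, 𝒞 ⊆ 𝒯' ∧ ⋃₀ (𝒞 : Set (Set (Fin (n + 1) → ℝ))) =
      graphOver S (fun x => Φ.F (Fin.snoc x (Φ.a x))))
    (hb : ∀ S ∈ Φ.Sτ, ∃ 𝒞, 𝒞 ⊆ 𝒯' ∧ ⋃₀ (𝒞 : Set (Set (Fin (n + 1) → ℝ))) =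
      graphOver S (fun x => Φ.F (Fin.snoc x (Φ.b x))))
    {D : Set (Fin (n + 1) → ℝ)} (hD : D ∈ 𝒯') (hDo : IsOpen D) {w : Fin (n + 1) → ℝ}
    (hw : w ∈ D) :
    ∑ p ∈ Φ.IL, Φ.εL p * (if w ∈ (Φ.lSheet p).domain then 1 else 0) =
      ∑ S ∈ Φ.IR, Φ.εR S * (if w ∈ (Φ.rSheet S).domain then 1 else 0) := by
  by_cases hxτ : Fin.init w ∈ Φ.r'.domain
  swap
  · rw [Finset.sum_eq_zero, Finset.sum_eq_zero]
    · intro S hS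
      obtain ⟨⟨hS𝒮, hSτ⟩, hSo, hpm⟩ := Φ.mem_IR.1 hS
      rw [Φ.rSheet_domain ⟨hS𝒮, hSo, hSτ⟩ hpm, soloInformed_indicator_image_shear_of_not_mem
        (Φ.slabRep_domain hS𝒮 hSτ) (fun h => hxτ (hSτ h)), mul_zero]
    · intro p hp
      obtain ⟨-, hB, hPN⟩ := Φ.mem_IL.1 hp
      rw [Φ.lSheet_domain (Φ.lCond_of_mem_IL hp) hPN, if_neg (soloInformed_not_mem_image_lastSubst
        (S := Φ.r'.domain) (fun z hz => ?_) hxτ), mul_zero]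
      have hzB := hB hz
      rw [Φ.hdom] at hzB
      exact hzB.1
  obtain ⟨S₀, ⟨hS₀', hx₀⟩, huniq⟩ := Φ.hpartS.2 (Fin.init w)
  have hS₀ : S₀ ∈ Φ.𝒮 := Finset.mem_coe.1 hS₀'
  have hS₀τ : S₀ ⊆ Φ.r'.domain := Φ.base_subset_of_mem hS₀ hx₀ hxτ
  have hne : ∀ S ∈ Φ.𝒮, S ≠ S₀ → Fin.init w ∉ S :=
    fun S hS hSne h => hSne (huniq S ⟨Finset.mem_coe.2 hS, h⟩)
  have hLz : ∀ p ∈ Φ.IL, p.1 ≠ S₀ → Φ.εL p * (if w ∈ (Φ.lSheet p).domain then 1 else 0) = 0 := by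
    intro p hp hp1
    obtain ⟨⟨hS𝒮, -⟩, -, hPN⟩ := Φ.mem_IL.1 hp
    rw [Φ.lSheet_domain (Φ.lCond_of_mem_IL hp) hPN, if_neg (soloInformed_not_mem_image_lastSubst
      (fun z hz => soloInformed_init_mem_of_mem_bandOver hz) (hne p.1 hS𝒮 hp1)), mul_zero]
  have hRz : ∀ S ∈ Φ.IR, S ≠ S₀ → Φ.εR S * (if w ∈ (Φ.rSheet S).domain then 1 else 0) = 0 := by
    intro S hS hSne
    obtain ⟨⟨hS𝒮, hSτ⟩, hSo, hpm⟩ := Φ.mem_IR.1 hS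
    rw [Φ.rSheet_domain ⟨hS𝒮, hSo, hSτ⟩ hpm, soloInformed_indicator_image_shear_of_not_mem
      (Φ.slabRep_domain hS𝒮 hSτ) (hne S hS𝒮 hSne), mul_zero]
  by_cases hS₀o : IsOpen S₀
  swap
  · rw [Finset.sum_eq_zero fun p hp => hLz p hp fun h => hS₀o (h ▸ (Φ.mem_IL.1 hp).1.2),
      Finset.sum_eq_zero fun S hS => hRz S hS fun h => hS₀o (h ▸ (Φ.mem_IR.1 hS).2.1)]
  have hS₀Sτ : S₀ ∈ Φ.Sτ := by simp [Sτ, hS₀, hS₀τ]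
  obtain ⟨𝒞a, h𝒞a, hUa⟩ := ha S₀ hS₀Sτ
  obtain ⟨𝒞b, h𝒞b, hUb⟩ := hb S₀ hS₀Sτ
  have hy₁ := soloInformed_ne_of_openCell h𝒯'
    (Φ.isSemialgebraicFunOn_ha.mono hS₀τ (Φ.h𝒮.isSemialgebraic S₀ hS₀)) h𝒞a hUa hD hDo hw hx₀
  have hy₂ := soloInformed_ne_of_openCell h𝒯'
    (Φ.isSemialgebraicFunOn_hb.mono hS₀τ (Φ.h𝒮.isSemialgebraic S₀ hS₀)) h𝒞b hUb hD hDo hw hx₀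
  have hy : ∀ (j : Fin (Φ.lS S₀ + 1)) (h0 : j ≠ 0) (hl : j ≠ Fin.last (Φ.lS S₀)),
      bandOver S₀ (Φ.ξ S₀) j ⊆ Φ.r.domain →
        w (Fin.last n) ≠ Φ.F (Fin.snoc (Fin.init w) (Φ.ξ S₀ (j.pred h0) (Fin.init w))) ∧
        w (Fin.last n) ≠ Φ.F (Fin.snoc (Fin.init w) (Φ.ξ S₀ (j.castPred hl) (Fin.init w))) := by
    intro j h0 hl hjB
    have hp : (⟨S₀, j⟩ : Σ S : Set (Fin n → ℝ), Fin (Φ.lS S + 1)) ∈ Φ.𝒮.sigma Φ.JB :=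
      Finset.mem_sigma.2 ⟨hS₀, Φ.mem_JB.2 hjB⟩
    obtain ⟨𝒞₁, h𝒞₁, hU₁⟩ := hlo _ hp
    obtain ⟨𝒞₂, h𝒞₂, hU₂⟩ := hhi _ hp
    dsimp only at hU₁ hU₂
    rw [Φ.crossLo_eq h0] at hU₁
    rw [Φ.crossHi_eq hl] at hU₂
    exact ⟨soloInformed_ne_of_openCell h𝒯' (Φ.isSemialgebraicFunOn_crossLo hS₀ hjB h0) h𝒞₁ hU₁
        hD hDo hw hx₀,
      soloInformed_ne_of_openCell h𝒯' (Φ.isSemialgebraicFunOn_crossHi hS₀ hjB hl) h𝒞₂ hU₂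
        hD hDo hw hx₀⟩
  have hL : ∑ p ∈ Φ.IL, Φ.εL p * (if w ∈ (Φ.lSheet p).domain then 1 else 0) =
      soloInformedSInd (Φ.F (Fin.snoc (Fin.init w) (Φ.a (Fin.init w))))
        (Φ.F (Fin.snoc (Fin.init w) (Φ.b (Fin.init w)))) (w (Fin.last n)) := by
    rw [IL, Finset.sum_sigma, Finset.sum_eq_single_of_mem S₀ (Finset.mem_filter.2 ⟨hS₀, hS₀o⟩)
      (fun S hS hSne => Finset.sum_eq_zero fun j hj =>
        hLz ⟨S, j⟩ (Φ.mem_IL.2 ⟨Finset.mem_filter.1 hS, Φ.mem_JL.1 hj⟩) hSne),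
      ← Φ.sum_JL_eq_sInd hS₀ hS₀o hS₀τ hx₀ hy]
    refine Finset.sum_congr rfl fun j hj => ?_
    obtain ⟨hB, hPN⟩ := Φ.mem_JL.1 hj
    rw [Φ.lSheet_domain ⟨hS₀, soloInformed_isOpen_bandOver hS₀o (Φ.hcontξ S₀ hS₀) j, hB⟩ hPN]
  rw [hL]
  by_cases hpm : S₀ ⊆ Φ.τp ∨ S₀ ⊆ Φ.τm
  · rw [Finset.sum_eq_single_of_mem S₀ (Φ.mem_IR.2 ⟨⟨hS₀, hS₀τ⟩, hS₀o, hpm⟩)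
      (fun S hS hSne => hRz S hS hSne), Φ.rSheet_domain ⟨hS₀, hS₀o, hS₀τ⟩ hpm,
      Φ.εR_mul_indicator_eq_sInd hS₀ hS₀τ hpm hx₀ hy₁ hy₂]
  · have h0 : S₀ ⊆ Φ.τ0 := by
      rcases Φ.base_trichotomy hS₀ hS₀o hS₀τ with h | h | h
      · exact absurd (Or.inl h) hpm
      · exact absurd (Or.inr h) hpm
      · exact h
    rw [Finset.sum_eq_zero fun S hS => hRz S hS fun h => hpm (h ▸ (Φ.mem_IR.1 hS).2.2),
      Φ.hF_b _ hxτ, (h0 hx₀).2, add_zero, soloInformed_sInd_self]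

end SoloInformedNLFrame

end Summit.KontsevichZagierPeriods.KontsevichZagierPeriods.Theorems
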